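import Summits.HubbardSuperconductivity.HubbardSuperconductivity.Theorems.WidthHaldaneDefs
import Summits.HubbardSuperconductivity.HubbardSuperconductivity.Theorems.DeformationLadderLowEnergyRigidityTwistGauge
import Literature.MathematicalPhysics.QuantumLattice.HubbardTorusFluxGauge
import Literature.MathematicalPhysics.QuantumLattice.BdGBondHamiltonian
import Literature.MathematicalPhysics.QuantumLattice.PairCorrelationsProofs

/-!
# The twist gauge of the Hubbard tube: spreading the seam flux uniformly

Support file for the cruxes stated over `WidthHaldaneDefs` (routes `WidthHaldane`, `SeamInduction`;
items stmt-HubbardSuperconductivity-16311/16312/18509/18510). The seam twist `tubeTwist θ` puts the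
whole flux `θ` on the `M` bonds between the columns `-1` and `0`. Conjugating by the unitary
site-phase transformation `W_g = phaseGauge g` of the TWIST GAUGE `g_z = e^{iθ z₁/L}`
(`z₁ ∈ {0,…,L-1}` the representative of the long coordinate) spreads it: the total coefficient of
every hopping `c†_{xσ} c_{yσ}` in `W_g (tubeH0 + tubeTwist θ) W_gᴴ` is the UNIFORM Peierls weight
`-e^{± iθ/L}` on the longitudinal bonds and `-1` on the transverse ones (Watanabe 2019 §2.2.3,
`U_m† H U_m = H^{(2πm/L,…)}`; the Lieb–Schultz–Mattis twist). Everything is PROVED, for `L ≥ 3`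
where needed (for `L = 2` the long cycle degenerates); no definitions, no named facts. The gauge
conjugation of the graph Hubbard Hamiltonian (`phaseGauge_conj_hamiltonian`,
`expect_phaseGauge_conj_hamiltonian`, `expect_hamiltonian_eq`; Koma–Tasaki 1992 eqs. (7)–(8)) is
REUSED from route `DeformationLadder`'s support file.

* `phaseGauge_conj_hop` — `W_g c†_{xσ} c_{yτ} W_gᴴ = g_x conj(g_y) c†_{xσ} c_{yτ}`;
* `sum_seam_eq_sum_sum` — the seam sum `Σ_b` as a guarded double sum over ordered pairs of sites;
* `gauge_pointwise` — the pointwise identity of coefficients (graph term + two seam terms =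
  uniform Peierls weight), by cases on the relative position of the pair in `ℤ/L × ℤ/M`;
* `expect_gauged_tubeH` — in expectation: `⟨ψ, W_g (H₀ + Tw_θ) W_gᴴ ψ⟩ = -Σ_{x∼y,σ} ω_θ(x,y)
  ⟨ψ, c†_{xσ}c_{yσ} ψ⟩ + U ⟨ψ, Σ_x n_{x↑}n_{x↓} ψ⟩`.

References: H. Watanabe, J. Stat. Phys. 177 (2019) 717, §2.2.3, §4.1; T. Koma, H. Tasaki, PRL 68
(1992) 3248, eqs. (5)–(8); E. Lieb, T. Schultz, D. Mattis, Ann. Phys. 16 (1961) 407.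
-/

noncomputable section

namespace Summit.HubbardSuperconductivity.HubbardSuperconductivity.Theorems.WidthHaldane

set_option linter.dupNamespace false -- summit = problem name (single-conjunct summit), D-0017

open scoped BigOperators Classical Matrix ComplexConjugate
open Matrix Literature.MathematicalPhysics.QuantumLattice
open Summit.HubbardSuperconductivity.HubbardSuperconductivity.Theorems.DeformationLadder
  (phaseGauge_conj_hamiltonian expect_phaseGauge_conj_hamiltonian expect_hamiltonian_eq)


section Gauge

variable {Λ : Type} [LinearOrder Λ] [Fintype Λ]

/-- Gauge conjugation of one hopping monomial: `W_g c†_{xσ} c_{yτ} W_gᴴ = g_x conj(g_y) c†_{xσ} c_{yτ}`.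
Koma–Tasaki, PRL 68 (1992) 3248, eqs. (7)–(8). [cite: KomaTasakiPRL1992, eqs. (7)–(8)] -/
theorem phaseGauge_conj_hop (g : Λ → Circle) (x y : Λ) (σ τ : Fin 2) :
    phaseGauge g * (creation (orb x σ) * annihilation (orb y τ)) * (phaseGauge g)ᴴ =
      ((g x : ℂ) * conj (g y : ℂ)) • (creation (orb x σ) * annihilation (orb y τ)) := by
  rw [phaseGauge_mul_mul_mul_conjTranspose, phaseGauge_mul_creation_mul_conjTranspose,
    phaseGauge_mul_annihilation_mul_conjTranspose, smul_mul_smul_comm]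

end Gauge

section Bloch

variable (L M : ℕ) [NeZero L] [NeZero M] (Λ : Type) [LinearOrder Λ] [Fintype Λ]
  (e : Λ ≃ ZMod L × ZMod M)

/-! ### The seam sum as a double sum over ordered pairs -/

/-- Re-indexing the seam: `Σ_b F(e⁻¹(0,b), e⁻¹(-1,b)) = Σ_{x,y} [x₁ = 0 ∧ y = e⁻¹(-1, x₂)] F(x,y)`.
[folklore] -/
theorem sum_seam_eq_sum_sum {β : Type*} [AddCommMonoid β] (F : Λ → Λ → β) :
    ∑ b : ZMod M, F (e.symm (0, b)) (e.symm (-1, b)) =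
      ∑ x : Λ, ∑ y : Λ, if (e x).1 = 0 ∧ y = e.symm (-1, (e x).2) then F x y else 0 := by
  have h1 : ∀ x : Λ, (∑ y : Λ, if (e x).1 = 0 ∧ y = e.symm (-1, (e x).2) then F x y else 0) =
      if (e x).1 = 0 then F x (e.symm (-1, (e x).2)) else 0 := by
    intro x
    by_cases hx : (e x).1 = 0
    · simp only [hx, true_and, if_true]
      rw [Finset.sum_ite_eq' Finset.univ (e.symm (-1, (e x).2)) (fun y => F x y),
        if_pos (Finset.mem_univ _)]
    · simp [hx]
  simp only [h1]
  rw [← e.symm.sum_comp, Fintype.sum_prod_type, Finset.sum_comm]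
  simp only [Equiv.apply_symm_apply, Finset.sum_ite_eq', Finset.mem_univ, if_true]

/-- The reversed seam, re-indexed: `Σ_b F(e⁻¹(-1,b), e⁻¹(0,b)) = Σ_{x,y} [y₁ = 0 ∧ x = e⁻¹(-1, y₂)] F(x,y)`.
[folklore] -/
theorem sum_seam_eq_sum_sum' {β : Type*} [AddCommMonoid β] (F : Λ → Λ → β) :
    ∑ b : ZMod M, F (e.symm (-1, b)) (e.symm (0, b)) =
      ∑ x : Λ, ∑ y : Λ, if (e y).1 = 0 ∧ x = e.symm (-1, (e y).2) then F x y else 0 := by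
  have h := sum_seam_eq_sum_sum L M Λ e (fun y x => F x y)
  rw [h, Finset.sum_comm]

/-! ### `ZMod` bookkeeping -/

omit [NeZero L] [NeZero M] in
/-- `(2 : ℤ/L) ≠ 0` for `L ≥ 3`. [folklore] -/
theorem two_ne_zero_zmod (hL : 3 ≤ L) : (2 : ZMod L) ≠ 0 := by
  intro h
  have h' : ((2 : ℕ) : ZMod L) = 0 := by exact_mod_cast h
  have hd := (ZMod.natCast_eq_zero_iff 2 L).1 h'
  have := Nat.le_of_dvd (by norm_num) hd
  omega

omit [NeZero L] [NeZero M] in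
/-- In `ℤ/L`, `L ≥ 3`: `a = a' + 1` and `a' = a + 1` cannot both hold. [folklore] -/
theorem not_both_steps (hL : 3 ≤ L) {a a' : ZMod L} (h1 : a = a' + 1) (h2 : a' = a + 1) : False := by
  apply two_ne_zero_zmod L hL
  have h3 : a = a + 1 + 1 := by
    conv_lhs => rw [h1, h2]
  linear_combination -h3

omit [NeZero M] in
/-- On the seam, `a = -1` has real representative `L - 1`. [folklore] -/
theorem val_cast_of_eq_neg_one {a : ZMod L} (ha : a = -1) : (a.val : ℝ) = L - 1 := by
  have h := (zmod_eq_neg_one_iff_val a).1 ha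
  have h' : (((a.val + 1 : ℕ)) : ℝ) = L := by exact_mod_cast h
  push_cast at h'
  linarith

omit [NeZero L] [NeZero M] in
/-- Off the seam the real representative of `a + 1` is that of `a` plus one (`L ≥ 3`). [folklore] -/
theorem val_cast_add_one (hL : 3 ≤ L) {a : ZMod L} (ha : a ≠ -1) :
    ((a + 1).val : ℝ) = a.val + 1 := by
  have h := zmod_val_add_one_of_ne_neg_one (L := L) (by omega) ha
  exact_mod_cast h

/-! ### The twist gauge and the uniform Peierls weights -/

omit [NeZero L] [NeZero M] [LinearOrder Λ] [Fintype Λ] in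
/-- The product of twist-gauge phases as one exponential:
`g_x conj(g_y) = e^{i(θ/L)(x₁ - y₁)}` for `g_z = e^{iθ z₁/L}`. [folklore] -/
theorem twistGauge_mul_conj (θ : ℝ) (x y : Λ) :
    (Circle.exp (θ / L * ((e x).1.val : ℝ)) : ℂ) * conj (Circle.exp (θ / L * ((e y).1.val : ℝ)) : ℂ) =
      Complex.exp (((θ / L * ((e x).1.val : ℝ) : ℝ) - (θ / L * ((e y).1.val : ℝ) : ℝ) : ℂ) * Complex.I) := by
  rw [Circle.coe_exp, Circle.coe_exp, ← Complex.exp_conj, map_mul, Complex.conj_ofReal, Complex.conj_I,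
    ← Complex.exp_add]
  congr 1
  ring

omit [NeZero M] [Fintype Λ] in
/-- **The pointwise gauge identity** (`L ≥ 3`). After conjugating the seam-twisted tube by the
twist gauge `g_z = e^{iθ z₁/L}`, the total coefficient of the hopping `c†_{xσ} c_{yσ}` — graph term
plus the two seam terms — is `-e^{iθ/L}` if `x = y + e₁`, `-e^{-iθ/L}` if `y = x + e₁`, `-1` on the
transverse bonds and `0` otherwise: the seam flux is spread uniformly (Watanabe 2019 §2.2.3,
`U_m† H U_m = H^{(2πm/L,…)}`). [cite: Watanabe2019, §2.2.3 and §4.1] -/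
theorem gauge_pointwise (hL : 3 ≤ L) (θ : ℝ) (x y : Λ) :
    -(if (tubeGraph e).Adj x y then
        (Circle.exp (θ / L * ((e x).1.val : ℝ)) : ℂ) * conj (Circle.exp (θ / L * ((e y).1.val : ℝ)) : ℂ)
        else 0) +
      (if (e x).1 = 0 ∧ y = e.symm (-1, (e x).2) then (1 - Complex.exp (Complex.I * θ)) *
        ((Circle.exp (θ / L * ((e x).1.val : ℝ)) : ℂ) * conj (Circle.exp (θ / L * ((e y).1.val : ℝ)) : ℂ))
        else 0) +
      (if (e y).1 = 0 ∧ x = e.symm (-1, (e y).2) then (1 - Complex.exp (-(Complex.I * θ))) *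
        ((Circle.exp (θ / L * ((e x).1.val : ℝ)) : ℂ) * conj (Circle.exp (θ / L * ((e y).1.val : ℝ)) : ℂ))
        else 0) =
    -(if (tubeGraph e).Adj x y then
        (if (e x).1 = (e y).1 + 1 ∧ (e x).2 = (e y).2 then Complex.exp (((θ / L : ℝ) : ℂ) * Complex.I)
          else if (e y).1 = (e x).1 + 1 ∧ (e x).2 = (e y).2 then Complex.exp (-(((θ / L : ℝ) : ℂ) * Complex.I))
          else 1)
        else 0) := by
  haveI : Fact (1 < L) := ⟨by omega⟩
  rw [twistGauge_mul_conj]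
  have hL0 : (L : ℂ) ≠ 0 := by exact_mod_cast (NeZero.ne L)
  have hfac : ∀ E W : ℂ, -E + (1 - W) * E = -(W * E) := fun E W => by ring
  -- coordinates
  obtain ⟨⟨a, b⟩, rfl⟩ := e.symm.surjective x
  obtain ⟨⟨a', b'⟩, rfl⟩ := e.symm.surjective y
  simp only [Equiv.apply_symm_apply, EmbeddingLike.apply_eq_iff_eq, SimpleGraph.fromRel_adj, tubeGraph,
    ne_eq, Prod.mk.injEq]
  by_cases h1 : a = a' + 1 ∧ b = b'
  · -- `x = y + e₁`
    obtain ⟨ha, hb⟩ := h1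
    have hadj : (¬(a = a' ∧ b = b') ∧ ((a' = a + 1 ∧ b' = b ∨ a' = a ∧ b' = b + 1) ∨
        (a = a' + 1 ∧ b = b' ∨ a = a' ∧ b = b' + 1))) := by
      refine ⟨fun h => ?_, Or.inr (Or.inl ⟨ha, hb⟩)⟩
      have h0 : (1 : ZMod L) = 0 := by linear_combination ha.symm.trans h.1
      exact one_ne_zero h0
    rw [if_pos hadj, if_pos hadj, if_pos (show a = a' + 1 ∧ b = b' from ⟨ha, hb⟩)]
    -- the reversed seam term is absent
    have hS' : ¬ (a' = 0 ∧ (a = -1 ∧ b = b')) := by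
      rintro ⟨h0, hm, -⟩
      apply two_ne_zero_zmod L hL
      have h11 : (1 : ZMod L) = -1 := by rw [← hm, ha, h0, zero_add]
      linear_combination h11
    rw [if_neg hS', add_zero]
    by_cases hs : a' = -1
    · -- seam bond
      have ha0 : a = 0 := by rw [ha, hs, neg_add_cancel]
      rw [if_pos (show a = 0 ∧ (a' = -1 ∧ b' = b) from ⟨ha0, hs, hb.symm⟩), hfac, ← Complex.exp_add,
        ha0, ZMod.val_zero, val_cast_of_eq_neg_one L hs, Nat.cast_zero, mul_zero]
      congr 2
      push_cast
      field_simp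
      ring
    · -- ordinary bond
      have hS : ¬ (a = 0 ∧ (a' = -1 ∧ b' = b)) := fun h => hs h.2.1
      rw [if_neg hS, add_zero, ha, val_cast_add_one L hL hs]
      congr 2
      push_cast
      ring
  · by_cases h2 : a' = a + 1 ∧ b = b'
    · -- `y = x + e₁`
      obtain ⟨ha, hb⟩ := h2
      have hadj : (¬(a = a' ∧ b = b') ∧ ((a' = a + 1 ∧ b' = b ∨ a' = a ∧ b' = b + 1) ∨
          (a = a' + 1 ∧ b = b' ∨ a = a' ∧ b = b' + 1))) := by
        refine ⟨fun h => ?_, Or.inl (Or.inl ⟨ha, hb.symm⟩)⟩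
        have h0 : (1 : ZMod L) = 0 := by linear_combination ha.symm.trans h.1.symm
        exact one_ne_zero h0
      rw [if_pos hadj, if_pos hadj, if_neg h1, if_pos (show a' = a + 1 ∧ b = b' from ⟨ha, hb⟩)]
      have hS : ¬ (a = 0 ∧ (a' = -1 ∧ b' = b)) := by
        rintro ⟨h0, hm, -⟩
        apply two_ne_zero_zmod L hL
        have h11 : (1 : ZMod L) = -1 := by rw [← hm, ha, h0, zero_add]
        linear_combination h11
      rw [if_neg hS, add_zero]
      by_cases hs : a = -1
      · -- seam bond, reversed orientation
        have ha0 : a' = 0 := by rw [ha, hs, neg_add_cancel]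
        rw [if_pos (show a' = 0 ∧ (a = -1 ∧ b = b') from ⟨ha0, hs, hb⟩), hfac, ← Complex.exp_add,
          ha0, ZMod.val_zero, val_cast_of_eq_neg_one L hs, Nat.cast_zero, mul_zero]
        congr 2
        push_cast
        field_simp
        ring
      · have hS' : ¬ (a' = 0 ∧ (a = -1 ∧ b = b')) := fun h => hs h.2.1
        rw [if_neg hS', add_zero, ha, val_cast_add_one L hL hs]
        congr 2
        push_cast
        ring
    · -- no longitudinal step: transverse bond or no bond; no seam term
      have hS : ¬ (a = 0 ∧ (a' = -1 ∧ b' = b)) := by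
        rintro ⟨h0, hm, hb⟩
        exact h1 ⟨by rw [h0, hm, neg_add_cancel], hb.symm⟩
      have hS' : ¬ (a' = 0 ∧ (a = -1 ∧ b = b')) := by
        rintro ⟨h0, hm, hb⟩
        exact h2 ⟨by rw [h0, hm, neg_add_cancel], hb⟩
      rw [if_neg hS, if_neg hS', add_zero, add_zero, if_neg h1, if_neg h2]
      by_cases hadj : (¬(a = a' ∧ b = b') ∧ ((a' = a + 1 ∧ b' = b ∨ a' = a ∧ b' = b + 1) ∨
          (a = a' + 1 ∧ b = b' ∨ a = a' ∧ b = b' + 1)))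
      · rw [if_pos hadj, if_pos hadj]
        -- transverse: `a = a'`
        have haa : a = a' := by
          rcases hadj.2 with (h | h) | (h | h)
          · exact absurd ⟨h.1, h.2.symm⟩ h2
          · exact h.1.symm
          · exact absurd h h1
          · exact h.1
        rw [haa, sub_self, zero_mul, Complex.exp_zero]
      · rw [if_neg hadj, if_neg hadj, neg_zero]

end Bloch


section BlochAssembly

variable (L M : ℕ) [NeZero L] [NeZero M] (Λ : Type) [LinearOrder Λ] [Fintype Λ]
  (e : Λ ≃ ZMod L × ZMod M)

/-- The expectation of the gauge-conjugated seam twist: every seam amplitude picks up the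
twist-gauge phase. [cite: KomaTasakiPRL1992, eqs. (7)–(8)] -/
theorem expect_phaseGauge_conj_tubeTwist (g : Λ → Circle) (θ : ℝ) (ψ : Fock (Orb Λ)) :
    expect (phaseGauge g * tubeTwist L M Λ e θ * (phaseGauge g)ᴴ) ψ =
      ∑ b : ZMod M, ∑ σ : Fin 2,
        ((1 - Complex.exp (Complex.I * θ)) *
            (((g (e.symm (0, b)) : ℂ) * conj (g (e.symm (-1, b)) : ℂ)) *
              expect (creation (orb (e.symm (0, b)) σ) * annihilation (orb (e.symm (-1, b)) σ)) ψ) +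
          (1 - Complex.exp (-(Complex.I * θ))) *
            (((g (e.symm (-1, b)) : ℂ) * conj (g (e.symm (0, b)) : ℂ)) *
              expect (creation (orb (e.symm (-1, b)) σ) * annihilation (orb (e.symm (0, b)) σ)) ψ)) := by
  unfold tubeTwist
  simp only [Finset.mul_sum, Finset.sum_mul, Matrix.mul_add, Matrix.add_mul, Matrix.mul_smul,
    Matrix.smul_mul, phaseGauge_conj_hop, expect_sum, expect_add, expect_smul]

omit [NeZero L] [NeZero M] [LinearOrder Λ] in
/-- Moving a two-term sum through a guard. [folklore] -/
theorem ite_sum_fin_two (c : Prop) [Decidable c] (f : Fin 2 → ℂ) :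
    (if c then ∑ σ : Fin 2, f σ else 0) = ∑ σ : Fin 2, if c then f σ else 0 := by
  split_ifs <;> simp

/-- **The gauged, seam-twisted tube in expectation** (`L ≥ 3`): for the twist gauge
`g_z = e^{iθ z₁/L}`, `⟨ψ, W_g (H₀ + Tw_θ) W_gᴴ ψ⟩ = -Σ_{x∼y,σ} ω_θ(x,y) ⟨ψ, c†_{xσ}c_{yσ} ψ⟩ + U⟨ψ, Σ n↑n↓ ψ⟩`
with the UNIFORM Peierls weights `ω_θ = e^{± iθ/L}` on the longitudinal bonds and `1` on the
transverse ones (Watanabe 2019 §2.2.3). [cite: Watanabe2019, §2.2.3 and §4.1] -/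
theorem expect_gauged_tubeH (hL : 3 ≤ L) (U θ : ℝ) (ψ : Fock (Orb Λ)) :
    expect (phaseGauge (fun z : Λ => Circle.exp (θ / L * ((e z).1.val : ℝ))) *
        (tubeH0 L M Λ e U + tubeTwist L M Λ e θ) *
        (phaseGauge (fun z : Λ => Circle.exp (θ / L * ((e z).1.val : ℝ))))ᴴ) ψ =
      -(∑ x : Λ, ∑ y : Λ, ∑ σ : Fin 2, if (tubeGraph e).Adj x y then
          (if (e x).1 = (e y).1 + 1 ∧ (e x).2 = (e y).2 then Complex.exp (((θ / L : ℝ) : ℂ) * Complex.I)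
            else if (e y).1 = (e x).1 + 1 ∧ (e x).2 = (e y).2 then Complex.exp (-(((θ / L : ℝ) : ℂ) * Complex.I))
            else 1) * expect (creation (orb x σ) * annihilation (orb y σ)) ψ
          else 0) +
        (U : ℂ) * expect (∑ x : Λ, numberOp x 0 * numberOp x 1) ψ := by
  rw [Matrix.mul_add, Matrix.add_mul, expect_add, tubeH0_eq, expect_phaseGauge_conj_hamiltonian,
    expect_phaseGauge_conj_tubeTwist]
  simp only [Finset.sum_add_distrib]
  -- the two seam sums as double sums over ordered pairs
  rw [sum_seam_eq_sum_sum L M Λ e (fun x y => ∑ σ : Fin 2, (1 - Complex.exp (Complex.I * θ)) *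
      (((Circle.exp (θ / L * ((e x).1.val : ℝ)) : ℂ) * conj (Circle.exp (θ / L * ((e y).1.val : ℝ)) : ℂ)) *
        expect (creation (orb x σ) * annihilation (orb y σ)) ψ)),
    sum_seam_eq_sum_sum' L M Λ e (fun x y => ∑ σ : Fin 2, (1 - Complex.exp (-(Complex.I * θ))) *
      (((Circle.exp (θ / L * ((e x).1.val : ℝ)) : ℂ) * conj (Circle.exp (θ / L * ((e y).1.val : ℝ)) : ℂ)) *
        expect (creation (orb x σ) * annihilation (orb y σ)) ψ))]
  simp only [ite_sum_fin_two]
  -- everything under one triple sum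
  rw [Complex.ofReal_one, neg_one_mul, add_assoc, add_comm ((U : ℂ) * _), ← add_assoc, ← add_assoc,
    add_left_inj]
  simp only [← Finset.sum_neg_distrib, ← Finset.sum_add_distrib]
  refine Finset.sum_congr rfl fun x _ => Finset.sum_congr rfl fun y _ => Finset.sum_congr rfl fun σ _ => ?_
  have key := gauge_pointwise L M Λ e hL θ x y
  split_ifs at key ⊢ <;>
    linear_combination (expect (creation (orb x σ) * annihilation (orb y σ)) ψ) * key

end BlochAssembly

end Summit.HubbardSuperconductivity.HubbardSuperconductivity.Theorems.WidthHaldane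

end
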